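import Summits.QuantumAdvantage.QuantumAdvantage.Theses.LinnikCubicClassGroups
import Literature.Computability.Cryptography.HallgrenShiftParams
import Literature.Computability.Complexity.CodeFPStrings

/-!
# Crux `LinnikCubicClassGroups.PureCubicClassGroupFBQP` (stmt-QuantumAdvantage-11544) — stub `stub_cubicSSParams`

Line `arakelov-giant-step-cycle`, stub `stub_cubicSSParams` (S5b-P1): THE SHIFT-SAMPLING PARAMETER BUNDLE
of the class-group stage. For every layout constant `c ≥ 1` we exhibit the shape
`P : ShiftSampling.SSParams` with

* `nU n = 2^16 (n + 1)` units,
* block length `L n = c (n + 1)²` (`Q = 2^L`),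
* levels `Lv n = L n + 1`,
* repetitions `B n = 2^20 (L n + 1) (n + 1)`,

(all positive and monotone in the input length `n`), its counter expressions `Γ : P.GEParams`
(polynomial expressions in the single counter variable `uu`, evaluating to the parameters, as the
uniformity proof `ShiftSampling.SSParams.family_isUniform` requires), the four unary `CodeFP` facts
(the parameters are computed in polynomial time from `1ⁿ`), and the accuracy defect of one trial
`ηacc (Lv n) (B n) = 2 · Lv · 64 / B = 1 / (2^13 (n + 1))`.

This is a direct adaptation of the template `Literature/Computability/Cryptography/HallgrenShiftParams.lean`
(`hallgrenSS`, `hallgrenGE`, `nU_un`, `L_un`, `Lv_un`, `B_un`); the structures are built inside the proof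
(no definitions in a Theorems file).
-/

namespace Summit.QuantumAdvantage.QuantumAdvantage.Theorems.LinnikCubicClassGroups

open Literature.Computability.Complexity (CodeFP GExpr)
open Literature.Computability.Complexity.CodeFP (unE pairE unitE fst snd unSucc unMulConst ulength unitsMul replicateUnit)
open Literature.Computability.Cryptography (ShiftSampling.SSParams)
open Literature.Computability.Cryptography.PeriodFinding (ηacc)
open Literature.Computability.QuantumComplexity.RevSim (GE)

/-- The accuracy defect of the bundle: `2 (cm + 1) · 64 / (2^20 (cm + 1) (n + 1)) = 1 / (2^13 (n + 1))`
(here `m = (n + 1)²`). -/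
theorem ηacc_cubic (c n : ℕ) :
    ηacc (c * (n + 1) ^ 2 + 1) (2 ^ 20 * (c * (n + 1) ^ 2 + 1) * (n + 1)) = 1 / (2 ^ 13 * (n + 1)) := by
  unfold ηacc
  have h1 : ((c : ℝ) * ((n : ℝ) + 1) ^ 2 + 1) ≠ 0 := by positivity
  have h2 : ((n : ℝ) + 1) ≠ 0 := by positivity
  push_cast
  field_simp
  ring

/-- **S5b-P1 `stub_cubicSSParams`.** The shift-sampling bundle of the class-group stage: for every layout
constant `c ≥ 1`, parameters `nU = 2^16(n+1)` units, block length `L = c(n+1)²`, levels `Lv = L + 1`,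
repetitions `B = 2^20(L+1)(n+1)` (all positive and monotone), their counter expressions (`GEParams`,
polynomial expressions in the one variable `uu`), their unary `CodeFP` facts, and the accuracy defect
`ηacc(Lv, B) = 2·Lv·64/B = 1/(2^13(n+1))`. -/
theorem stub_cubicSSParams :
    ∀ c : ℕ, 1 ≤ c →
      ∃ (P : ShiftSampling.SSParams) (_Γ : P.GEParams),
        (∀ n, P.nU n = 2 ^ 16 * (n + 1)) ∧ (∀ n, P.L n = c * (n + 1) ^ 2) ∧ (∀ n, P.Lv n = c * (n + 1) ^ 2 + 1) ∧
        (∀ n, P.B n = 2 ^ 20 * (c * (n + 1) ^ 2 + 1) * (n + 1)) ∧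
        CodeFP unE unE P.nU ∧ CodeFP unE unE P.L ∧ CodeFP unE unE P.Lv ∧ CodeFP unE unE P.B ∧
        ∀ n, ηacc (P.Lv n) (P.B n) = 1 / (2 ^ 13 * (n + 1)) := by
  intro c hc
  -- unary multiplication on codes: `(1ᵃ, 1ᵇ) ↦ 1^{ab}` (the total length of `a` blocks of `b` units)
  have unMul : CodeFP (pairE unE unE) unE (fun p => p.1 * p.2) :=
    ((ulength unitE).comp (unitsMul.comp ((replicateUnit.comp (fst _ _)).pair (replicateUnit.comp (snd _ _))))).congr
      fun p => by simp
  -- the four unary `CodeFP` facts, bottom-up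
  have hnU : CodeFP unE unE (fun n => 2 ^ 16 * (n + 1)) := ((unMulConst (2 ^ 16)).comp unSucc :)
  have hS : CodeFP unE unE (fun n => (n + 1) * (n + 1)) := (unMul.comp (unSucc.pair unSucc) :)
  have hL : CodeFP unE unE (fun n => c * (n + 1) ^ 2) := ((unMulConst c).comp hS).congr fun n => by ring
  have hLv : CodeFP unE unE (fun n => c * (n + 1) ^ 2 + 1) := (unSucc.comp hL :)
  have hB : CodeFP unE unE (fun n => 2 ^ 20 * (c * (n + 1) ^ 2 + 1) * (n + 1)) :=
    ((unMulConst (2 ^ 20)).comp (unMul.comp (hLv.pair unSucc))).congr fun n => by ring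
  -- the counter expression of `n + 1` and of `L`
  let sE : GE := .add (.var .uu) (.const 1)
  let lE : GE := .mul (.const c) (.mul sE sE)
  refine ⟨⟨fun n => 2 ^ 16 * (n + 1), fun n => c * (n + 1) ^ 2, fun n => c * (n + 1) ^ 2 + 1,
      fun n => 2 ^ 20 * (c * (n + 1) ^ 2 + 1) * (n + 1),
      fun n => by positivity, fun n => Nat.mul_pos hc (by positivity), fun n => Nat.succ_pos _,
      fun n => by positivity,
      fun a b h => by dsimp only; gcongr, fun a b h => by dsimp only; gcongr,
      fun a b h => by dsimp only; gcongr, fun a b h => by dsimp only; gcongr⟩,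
    ⟨.mul (.const (2 ^ 16)) sE, lE, .add lE (.const 1), .mul (.mul (.const (2 ^ 20)) (.add lE (.const 1))) sE,
      fun env => rfl, fun env => ?_, fun env => ?_, fun env => ?_,
      fun x hx => ?_, fun x hx => ?_, fun x hx => ?_, fun x hx => ?_⟩,
    fun _ => rfl, fun _ => rfl, fun _ => rfl, fun _ => rfl, hnU, hL, hLv, hB, fun n => ηacc_cubic c n⟩
  · simp only [lE, sE, GExpr.eval]; ring
  · simp only [lE, sE, GExpr.eval]; ring
  · simp only [lE, sE, GExpr.eval]; ring
  · simpa [sE, GExpr.fv] using hx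
  · simpa [lE, sE, GExpr.fv] using hx
  · simpa [lE, sE, GExpr.fv] using hx
  · simpa [lE, sE, GExpr.fv] using hx

end Summit.QuantumAdvantage.QuantumAdvantage.Theorems.LinnikCubicClassGroups
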